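import Summits.ValiantsHypothesis.ValiantsHypothesis.Theorems.BarrierLeverChowCubeCertificate

/-!
# Route BarrierLever — item 20195, dense regime: «TARGET A ⟹ every FULL-thin-row layout is Chow-hit»

Helper file (`--supports stmt-ValiantsHypothesis-20195`; cell valiant-natproofs, rung V4, 𝒟-side of
door (c); seat val-np-p2 gen 8).  Closes NO item; definition-free.  A DOOR isolating what the dense
regime of item 20195 (`r = 1 + h + C(h,2)`, rows = ALL sets of size `≤ 2`, columns = ANY `r` sets)
still needs after the cube reduction:

**TARGET A** (hypothesis `hTA`, stated inline; the seat's conjecture, NOT a literature fact): for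
every `h`, every injective enumeration `u` of the sets of size `≤ 2` and every injective DOWN-CLOSED
family `δ` of the same length, the generic truncated-inverse matrix has `det Θ̂_X[u, δ] ≠ 0` in
`MvPolynomial (Fin h × Fin h) ℂ` (geometrically: the edge-average functionals of a generic simplex
`(0, q_1, …, q_h)` are unisolvent on `span{y^T : T ∈ δ}`).  Verified exhaustively by the seat for
`h ≤ 7` (13 / 621 / 144 505 / 179 691 656 down-closed families; kit j283933), proved in the tree for
the recursive class of `…ChowCubeThetaHatPeelStep` (rule (P1)) and for `δ = u ∘ σ` (`…ChowCubeSelfDual`).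

* `chow_hit_fullRows_of_targetA` — under `hTA`, every layout with the full thin row family and ANY
  injective column family is Chow-hit by `h + h` affine forms (cube reduction
  `exists_chowFactors_of_closedColumns` + `MvPolynomial.funext` + Γ-reduction
  `det_xPrivate_eq_det_thetaHat`; route-file independent).

WHAT THIS IS NOT: a conditional door; TARGET A is open beyond `h ≤ 7`; item 20195 stays open; nothing
on crux stmt-ValiantsHypothesis-14610 or on `VP` versus `VNP`.
-/

set_option linter.dupNamespace false

namespace Summit.ValiantsHypothesis.ValiantsHypothesis.Theorems.BarrierLever.ChowCube

open Finset MvPolynomial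

variable {h : ℕ}

/-- **TARGET A ⟹ the dense regime of item 20195.**  If for every injective enumeration `u` of the
sets of size `≤ 2` and every injective down-closed `δ` of the same length `det Θ̂_X[u, δ] ≠ 0`
(TARGET A, hypothesis), then every layout `(u, w)` with `u` the full thin row family and `w` injective
is Chow-hit by `h + h` affine forms. -/
theorem chow_hit_fullRows_of_targetA
    (hTA : ∀ (r : ℕ) (u δ : Fin r → Finset (Fin h)), Function.Injective u →
      (∀ S : Finset (Fin h), (∃ i, u i = S) ↔ S.card ≤ 2) → Function.Injective δ →
      (∀ j, ∀ c ∈ δ j, ∃ j', δ j' = (δ j).erase c) →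
      (Matrix.of fun i j : Fin r => coeff
        (∑ a ∈ (∅ : Finset (Fin h)), Finsupp.single (Fin.castAdd h a) 1 +
            ∑ c ∈ δ j, Finsupp.single (Fin.natAdd h c) 1)
          (∏ a ∈ u i, ∑ S' ∈ (Finset.univ : Finset (Fin h)).powerset,
            monomial (∑ a' ∈ (∅ : Finset (Fin h)), Finsupp.single (Fin.castAdd h a') 1 +
              ∑ c ∈ S', Finsupp.single (Fin.natAdd h c) 1)
              ((-1 : MvPolynomial (Fin h × Fin h) ℂ) ^ S'.card *
                (S'.card.factorial : MvPolynomial (Fin h × Fin h) ℂ) * ∏ c ∈ S', X (a, c)) :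
                MvPolynomial (Fin (h + h)) (MvPolynomial (Fin h × Fin h) ℂ))).det ≠ 0)
    {r : ℕ} (u w : Fin r → Finset (Fin h)) (hu : Function.Injective u)
    (hU : ∀ S : Finset (Fin h), (∃ i, u i = S) ↔ S.card ≤ 2) (hw : Function.Injective w) :
    ∃ ℓ : Fin (h + h) → MvPolynomial (Fin (h + h)) ℂ, (∀ k, (ℓ k).totalDegree ≤ 1) ∧
      (Matrix.of fun i j : Fin r => coeff
        (∑ a ∈ u i, Finsupp.single (Fin.castAdd h a) 1 + ∑ c ∈ w j, Finsupp.single (Fin.natAdd h c) 1)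
        (∏ k, ℓ k)).det ≠ 0 := by
  classical
  -- the cube reduction over all coordinates, with the DC hypothesis discharged by TARGET A
  have hDC : ∀ δ : Fin r → Finset (Fin h), Function.Injective δ →
      (∀ c ∈ (∅ : Finset (Fin h)) ∪ Finset.univ, ∀ j, c ∈ δ j → ∃ j', δ j' = (δ j).erase c) →
      ∃ g : Fin h → MvPolynomial (Fin (h + h)) ℂ, (∀ k, (g k).totalDegree ≤ 1) ∧
        (Matrix.of fun i j : Fin r => coeff
          (∑ a ∈ u i, Finsupp.single (Fin.castAdd h a) 1 +
            ∑ c ∈ δ j, Finsupp.single (Fin.natAdd h c) 1) (∏ k, g k)).det ≠ 0 := by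
    intro δ hδ hδcl'
    have hδcl : ∀ j, ∀ c ∈ δ j, ∃ j', δ j' = (δ j).erase c :=
      fun j c hc => hδcl' c (by simp) j hc
    have hdet := hTA r u δ hu hU hδ hδcl
    obtain ⟨x, hx⟩ : ∃ x : Fin h × Fin h → ℂ, MvPolynomial.eval x (Matrix.of fun i j : Fin r => coeff
          (∑ a ∈ (∅ : Finset (Fin h)), Finsupp.single (Fin.castAdd h a) 1 +
              ∑ c ∈ δ j, Finsupp.single (Fin.natAdd h c) 1)
            (∏ a ∈ u i, ∑ S' ∈ (Finset.univ : Finset (Fin h)).powerset,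
              monomial (∑ a' ∈ (∅ : Finset (Fin h)), Finsupp.single (Fin.castAdd h a') 1 +
                ∑ c ∈ S', Finsupp.single (Fin.natAdd h c) 1)
                ((-1 : MvPolynomial (Fin h × Fin h) ℂ) ^ S'.card *
                  (S'.card.factorial : MvPolynomial (Fin h × Fin h) ℂ) * ∏ c ∈ S', X (a, c)) :
                  MvPolynomial (Fin (h + h)) (MvPolynomial (Fin h × Fin h) ℂ))).det ≠ 0 := by
      by_contra hall
      push Not at hall
      exact hdet (MvPolynomial.funext fun x => by rw [hall x, map_zero])
    set q : Fin h → Fin h → ℂ := fun a c => x (a, c) with hq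
    rw [RingHom.map_det] at hx
    have hentry : (MvPolynomial.eval x).mapMatrix (Matrix.of fun i j : Fin r => coeff
          (∑ a ∈ (∅ : Finset (Fin h)), Finsupp.single (Fin.castAdd h a) 1 +
              ∑ c ∈ δ j, Finsupp.single (Fin.natAdd h c) 1)
            (∏ a ∈ u i, ∑ S' ∈ (Finset.univ : Finset (Fin h)).powerset,
              monomial (∑ a' ∈ (∅ : Finset (Fin h)), Finsupp.single (Fin.castAdd h a') 1 +
                ∑ c ∈ S', Finsupp.single (Fin.natAdd h c) 1)
                ((-1 : MvPolynomial (Fin h × Fin h) ℂ) ^ S'.card *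
                  (S'.card.factorial : MvPolynomial (Fin h × Fin h) ℂ) * ∏ c ∈ S', X (a, c)) :
                  MvPolynomial (Fin (h + h)) (MvPolynomial (Fin h × Fin h) ℂ))) =
        Matrix.of fun i j' : Fin r => coeff
          (∑ a ∈ (∅ : Finset (Fin h)), Finsupp.single (Fin.castAdd h a) 1 +
              ∑ c ∈ δ j', Finsupp.single (Fin.natAdd h c) 1)
            (∏ a ∈ u i, ∑ S ∈ (Finset.univ : Finset (Fin h)).powerset,
              monomial (∑ a' ∈ (∅ : Finset (Fin h)), Finsupp.single (Fin.castAdd h a') 1 +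
                ∑ c ∈ S, Finsupp.single (Fin.natAdd h c) 1)
                ((-1 : ℂ) ^ S.card * (S.card.factorial : ℂ) * ∏ c ∈ S, q a c) :
                  MvPolynomial (Fin (h + h)) ℂ) := by
      ext i j
      rw [RingHom.mapMatrix_apply, Matrix.map_apply, Matrix.of_apply, Matrix.of_apply, map_thetaHat]
      simp_rw [eval_X]
      rfl
    rw [hentry, ← det_xPrivate_eq_det_thetaHat q u δ hδ (downClosed_of_erase_closed δ fun c j hc =>
      hδcl j c hc)] at hx
    exact ⟨fun a => X (Fin.castAdd h a) + (1 + ∑ c, C (q a c) * X (Fin.natAdd h c)),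
      fun a => totalDegree_xPrivateForm_le q a, hx⟩
  obtain ⟨g, hg, s, hdet⟩ := exists_chowFactors_of_closedColumns u h Finset.univ ∅ w hw
    (fun c hc => absurd hc (Finset.notMem_empty c)) hDC
  refine ⟨Fin.append g (fun c => C (s c) + X (Fin.natAdd h c)), fun q => ?_, ?_⟩
  · induction q using Fin.addCases with
    | left k =>
      rw [Fin.append_left]
      exact hg k
    | right c =>
      rw [Fin.append_right]
      exact totalDegree_C_add_X_natAdd_le (s c) c
  · have hprod : (∏ q, Fin.append g (fun c => C (s c) + X (Fin.natAdd h c)) q) =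
        (∏ k, g k) * ∏ c, (C (s c) + X (Fin.natAdd h c)) := by
      rw [Fin.prod_univ_add]
      simp only [Fin.append_left, Fin.append_right]
    rw [hprod]
    exact hdet

end Summit.ValiantsHypothesis.ValiantsHypothesis.Theorems.BarrierLever.ChowCube
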